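import Summits.AtomisticToContinuum.Crystallization.Theorems.FrustratedLawDichotomyStrainedPatchHomEntryTableHcpV
import Summits.AtomisticToContinuum.Crystallization.Theorems.FrustratedLawDichotomyStrainedPatchHomEntryQuick

/-!
# hcp QUICK VERDICT `entryLeafOKHQ` (v8 without the Gram-box leaf `leafOKH`) and its transfer to the verdict of record `entryLeafOKHVK`

decomp-a2c hand-2 g26 (crux `AperiodicFrustratedLawGap`, stmt-AtomisticToContinuum-27623; (H) hcp side, certificate v8 in the literal ∃-tree currency of
`…HomEntryTreeShard` / `…HomEntryTreeCert`).  MEASURED (hand-2 g26, farm, native `#eval`, relaxed-ray centre, entry/shuffle half-width `2⁻⁷`, a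
FAILING box): every disjunct of the hcp verdict of record `entryLeafOKHVK μ` (`…HomEntryTableHcpV`) costs < 0.5 s EXCEPT the last one reached through
`entryLeafOKH3RDTK → entryLeafOKH3R → entryLeafOKH3s → entryLeafOKH3 → entryLeafOKH2 → entryLeafOKHc → leafOKH` (the original 13-coordinate Gram-box
leaf of `…HomCertTreeHcp`), which costs ≈ 190 s natively — and a search pays it at EVERY failing (interior) node.  The quick verdict below keeps every
other disjunct of v8 (shuffle-sign prune, column prune, radial prune, both fit prunes, the four vector-form tables, the four class tables) and drops
only `leafOKH` (and the vacuous `asymOK` on a symmetrised box); pointwise `entryLeafOKHQ μ c w = true → entryLeafOKHVK μ c w = true`, so by hand-1's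
verdict monotonicity (`…HomEntryQuick.treeOK_of_imp` / `exists_tree_of_imp` / `searchOK_of_imp`) trees and search Booleans computed with the quick
verdict ARE certificates for the verdict of record: `exists_tree_HVK_of_HQ` feeds `hH` of `…HomEntryTreeCert.homFloor_625_of_entryTrees6RBKP_HVK`.

* `entryLeafOKHQ` (cheap-first: shuffle prune, V-tables K1–K4, fits, class tables, radial, column prune);
* ★ `entryLeafOKHQ_imp`; `treeOK_HVK_of_HQ`, ★ `exists_tree_HVK_of_HQ`, `searchOK_HVK_of_HQ`.

0 sorry; standard axioms; no instances / notation / `#eval`.  `--supports stmt-AtomisticToContinuum-27623`.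
-/

namespace Summit.AtomisticToContinuum.Crystallization.Theorems.FrustratedLawDichotomyStrainedPatchHomEntryQuickHcp

open Summit.AtomisticToContinuum.Crystallization.Theorems.FrustratedLawDichotomyStrainedPatchHomCertTree (CertTree treeOK)
open Summit.AtomisticToContinuum.Crystallization.Theorems.FrustratedLawDichotomyStrainedPatchHomEntrySearch (searchOK)
open Summit.AtomisticToContinuum.Crystallization.Theorems.FrustratedLawDichotomyStrainedPatchHomEntryGram (colOutOK)
open Summit.AtomisticToContinuum.Crystallization.Theorems.FrustratedLawDichotomyStrainedPatchHomEntryGramHcp (entryLeafOKHc)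
open Summit.AtomisticToContinuum.Crystallization.Theorems.FrustratedLawDichotomyStrainedPatchHomEntrySymBox (symH entryLeafOKH3s)
open Summit.AtomisticToContinuum.Crystallization.Theorems.FrustratedLawDichotomyStrainedPatchHomEntryFlipHcp (shufOut)
open Summit.AtomisticToContinuum.Crystallization.Theorems.FrustratedLawDichotomyStrainedPatchHomEntryRadialHcp (radOKH entryLeafOKH3R)
open Summit.AtomisticToContinuum.Crystallization.Theorems.FrustratedLawDichotomyStrainedPatchHomEntryFitHcpKit (fitOKH)
open Summit.AtomisticToContinuum.Crystallization.Theorems.FrustratedLawDichotomyStrainedPatchHomEntryFitHcp (entryLeafOKH2)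
open Summit.AtomisticToContinuum.Crystallization.Theorems.FrustratedLawDichotomyStrainedPatchHomEntryFitHcpSharpKit (fitOKHS)
open Summit.AtomisticToContinuum.Crystallization.Theorems.FrustratedLawDichotomyStrainedPatchHomEntryFitHcpSharp (entryLeafOKH3)
open Summit.AtomisticToContinuum.Crystallization.Theorems.FrustratedLawDichotomyStrainedPatchHomLeafTableCheck (qTableK1 qTableK2 qTableK3 qTableK4 tabE)
open Summit.AtomisticToContinuum.Crystallization.Theorems.FrustratedLawDichotomyStrainedPatchHomEntryTableHcp (entryLeafOKHTW entryLeafOKH3RDTK)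
open Summit.AtomisticToContinuum.Crystallization.Theorems.FrustratedLawDichotomyStrainedPatchHomLeafTableCheckHcpV (entryLeafOKHVT entryLeafOKHVK)
open Summit.AtomisticToContinuum.Crystallization.Theorems.FrustratedLawDichotomyStrainedPatchHomEntryQuick (treeOK_of_imp exists_tree_of_imp searchOK_of_imp)

/-- ★ **hcp QUICK VERDICT** (cheap-first, the 190-s Gram-box leaf `leafOKH` dropped): shuffle-sign prune ∨ vector-form tables K1–K4 (mirror) ∨ sharp fit ∨
fit ∨ class tables K1–K4 ∨ radial prune ∨ column prune — every disjunct is literally a disjunct of the expansion of `entryLeafOKHVK μ c w`. -/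
def entryLeafOKHQ (μ : ℤ) (c w : (Fin 3 × Fin 3) ⊕ Fin 3 → ℤ) : Bool :=
  shufOut c w || entryLeafOKHVT qTableK1 tabE μ c w || entryLeafOKHVT qTableK2 tabE μ c w || entryLeafOKHVT qTableK3 tabE μ c w ||
    entryLeafOKHVT qTableK4 tabE μ c w || fitOKHS (symH c) (symH w) || fitOKH (symH c) (symH w) ||
    entryLeafOKHTW qTableK1 tabE μ c w || entryLeafOKHTW qTableK2 tabE μ c w || entryLeafOKHTW qTableK3 tabE μ c w || entryLeafOKHTW qTableK4 tabE μ c w ||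
    radOKH (symH c) (symH w) || colOutOK (fun ab => symH c (Sum.inl ab)) (fun ab => symH w (Sum.inl ab))

/-- ★ **The quick verdict implies the verdict of record, pointwise.** [formal bookkeeping] -/
theorem entryLeafOKHQ_imp (μ : ℤ) (c w : (Fin 3 × Fin 3) ⊕ Fin 3 → ℤ) (h : entryLeafOKHQ μ c w = true) : entryLeafOKHVK μ c w = true := by
  simp only [entryLeafOKHQ, Bool.or_eq_true] at h
  simp only [entryLeafOKHVK, entryLeafOKH3RDTK, entryLeafOKH3R, entryLeafOKH3s, entryLeafOKH3, entryLeafOKH2, entryLeafOKHc, Bool.or_eq_true]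
  rcases h with (((((((((((h | h) | h) | h) | h) | h) | h) | h) | h) | h) | h) | h) | h
  · exact Or.inl (Or.inl (Or.inl (Or.inl (Or.inl h))))
  · exact Or.inl (Or.inl (Or.inl (Or.inl (Or.inr h))))
  · exact Or.inl (Or.inl (Or.inl (Or.inr h)))
  · exact Or.inl (Or.inl (Or.inr h))
  · exact Or.inl (Or.inr h)
  · exact Or.inr (Or.inr (Or.inr (Or.inl h)))
  · exact Or.inr (Or.inr (Or.inr (Or.inr (Or.inl h))))
  · exact Or.inr (Or.inl (Or.inl (Or.inl (Or.inl (Or.inr h)))))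
  · exact Or.inr (Or.inl (Or.inl (Or.inl (Or.inr h))))
  · exact Or.inr (Or.inl (Or.inl (Or.inr h)))
  · exact Or.inr (Or.inl (Or.inr h))
  · exact Or.inr (Or.inr (Or.inl h))
  · exact Or.inr (Or.inr (Or.inr (Or.inr (Or.inr (Or.inl (Or.inr h))))))

/-- Trees certified with the quick verdict are certified for the verdict of record. [formal bookkeeping] -/
theorem treeOK_HVK_of_HQ {μ : ℤ} {t : CertTree ((Fin 3 × Fin 3) ⊕ Fin 3)} {c w : (Fin 3 × Fin 3) ⊕ Fin 3 → ℤ}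
    (h : treeOK (entryLeafOKHQ μ) t c w = true) : treeOK (entryLeafOKHVK μ) t c w = true :=
  treeOK_of_imp (entryLeafOKHQ_imp μ) t c w h

/-- ★ ∃-tree facts computed with the quick verdict are facts for the verdict of record (hypothesis `hH` of
`…HomEntryTreeCert.homFloor_625_of_entryTrees6RBKP_HVK` at the root). [formal bookkeeping] -/
theorem exists_tree_HVK_of_HQ {μ : ℤ} {c w : (Fin 3 × Fin 3) ⊕ Fin 3 → ℤ}
    (h : ∃ t : CertTree ((Fin 3 × Fin 3) ⊕ Fin 3), treeOK (entryLeafOKHQ μ) t c w = true) :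
    ∃ t : CertTree ((Fin 3 × Fin 3) ⊕ Fin 3), treeOK (entryLeafOKHVK μ) t c w = true :=
  exists_tree_of_imp (entryLeafOKHQ_imp μ) h

/-- Search Booleans computed with the quick verdict transfer to the verdict of record (same selector / fuel / depth / box). [formal bookkeeping] -/
theorem searchOK_HVK_of_HQ {μ : ℤ} (sel : ℕ → ((Fin 3 × Fin 3) ⊕ Fin 3 → ℤ) → ((Fin 3 × Fin 3) ⊕ Fin 3 → ℤ) → (Fin 3 × Fin 3) ⊕ Fin 3)
    {fuel d : ℕ} {c w : (Fin 3 × Fin 3) ⊕ Fin 3 → ℤ} (h : searchOK (entryLeafOKHQ μ) sel fuel d c w = true) :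
    searchOK (entryLeafOKHVK μ) sel fuel d c w = true :=
  searchOK_of_imp (entryLeafOKHQ_imp μ) sel fuel d c w h

end Summit.AtomisticToContinuum.Crystallization.Theorems.FrustratedLawDichotomyStrainedPatchHomEntryQuickHcp
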